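import Summits.HodgeConjecture.HodgeConjecture.Theorems.MarkmanPartnerTransportCycleInducedOfKappaClass
import Summits.HodgeConjecture.HodgeConjecture.Theorems.MarkmanPartnerTransportK3Sq2TypeHodgeOfCycleInducedGenerator
import Summits.HodgeConjecture.HodgeConjecture.Theorems.MarkmanPartnerTransportPicardThreeK3SquaresVeryGeneralSpread
import Literature.AlgebraicGeometry.HodgeTheory.DominatedByPowersHodgeConjecture

/-!
# Route MarkmanPartnerTransport · crux #5 `LowPicardRealMultiplication` (stmt-HodgeConjecture-19653) ∕ #4 `PicardThreeK3Squares`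
# (stmt-HodgeConjecture-19652) — «NL-DESCENT-X»: modulo the displayed Noether–Lefschetz absorption families, the cell
# `(ρ(X), [E:ℚ]) = (3, 2)` is downstream of the ORPHAN cell `(1, 2)`

The `X`-side twin of `…PicardThreeK3SquaresNSAbsorption` ∕ `…NLAscentQuadratic` (K3 squares). REMARK NL-DESCENT-X (memo
RM-GEN-K3-19652-g19 §4, on top of memo NL-ASCENT §4): for EVERY marked projective `K3^{[2]}`-type fourfold `X` in crux #5's
cell `(3,2)` (`ρ(X) = 3`, `E = End_Hdg T(X) = ℚ(√D)` real quadratic) the indefinite ternary `NS(X)_ℚ` contains an AMPLE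
rational `h` with `h^⊥` a binary `ℚ(√D)`-trace form (Hilbert-symbol criterion + local universality of ternary forms +
density of global norms of negative sign + Hasse–Minkowski), so `T(X)_ℚ ⊕ h^⊥ ≅ E^{11}` carries `E` and `X` is a
NOETHER–LEFSCHETZ point of the 9-dimensional `E`-eigenperiod family whose very general member has `ρ = 1`, `E = ℚ(√D)`,
`rank_E T = 11` — the ORPHAN cell `(1,2)` (no K3 partner); the flat class `κ(e⁺)` of `e ∈ E` restricts at `X` to the kappa
class `κ(e)` PLUS a class in `Sym² NS(X)_ℚ` (products of divisors: algebraic). The family (universal family over the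
real-multiplication component of a polarised `K3^{[2]}`-type moduli space through `X`; Verbitsky–Markman Torelli,
Viehweg, Cattani–Deligne–Kaplan) is NOT constructed in the tree — it is DISPLAYED as a hypothesis, exactly as on the K3
side (moduli input (I1′-X)). This file proves the reduction it feeds:

* `hodgeConjectureFor_of_residualFamily_kappaClass` — for a marked smooth projective `K3^{[2]}`-type `X`, a rational,
  type-preserving, `q`-self-adjoint `θ` generating `End_Hdg T(X)` (the GEN clause of the `X`-side F4), a smooth projective
  family `g : 𝒳 → B` through `X ≅ 𝒳_{b₁}` (quasi-projective, smooth irreducible base) and a continuous (flat) section `σ` of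
  `R⁴ g_* ℂ` whose value at `b₁` is `κ_θ + w` with `w ∈ A²(X)` and whose values over a RESIDUAL set of `b` are rational
  `(2,2)`-classes on fibres satisfying HC⁴: **`HodgeConjectureFor 4 X`** — `σ(b₁)` is algebraic by the residual spread
  (`VeryGeneralSpread.forall_cls_mem_algebraicClasses_of_residual_hodgeConjectureFor_of_section`, Deligne's fixed part +
  Charles–Schnell + Baire), hence `κ_θ` is algebraic, hence `θ` is cycle-induced (T3C `exists_corrAction_eq_of_kappaClass`,
  mod Verbitsky–Guan + Charles–Markman), hence HC⁴(X) by the `X`-side F4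
  (`hodgeConjectureFor_of_cycleInducedGenerator_of_charlesMarkman`, + O'Grady);
* `cellHC_three_two_of_nlDescentX` — **`CellHC[3, 2]` (crux #5's real-quadratic `ρ(X) = 3` cell, BY NAME as in
  `…LowPicardRMCells`) follows from `CellHC[1, 2]` (the orphan cell) and the DISPLAYED absorption families `NLDescentX` for
  the members of cell `(3,2)` (residual fibres = marked `K3^{[2]}`-type fourfolds in cell `(1,2)`)**, modulo
  {Verbitsky–Guan, O'Grady, Charles–Markman}. With `…NLAscentQuadratic` (K3 squares: every real-quadratic type descends to
  Picard number 2, whose Hilbert squares lie in cell `(3,2)`) the whole real-quadratic sector of cruxes #4 and #5 funnels,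
  modulo the displayed families, into the very general members of cell `(1,2)`.

No definition, no sorry, no new named fact; CONDITIONAL on the three displayed facts and the displayed families; credits
nothing to HC (cell `(1,2)` is open). Prover seat hodge-nonav-19652-p1 (gen 19), `--supports stmt-HodgeConjecture-19653`.

References: C. Voisin, *Hodge Theory II* Thm. 4.18, §5.3.4, §7.3.2; F. Charles, C. Schnell, *Notes on absolute Hodge classes*
(2014) Prop. 11.3.11; B. van Geemen, M. Schütt, Forum Math. Sigma 13 (2025) e2 §2.6, Prop. 3.2, §3.4; O. T. O'Meara,
*Introduction to Quadratic Forms* 63:21, 66:3; E. Markman, Compos. Math. 160 (2024) Thm. 1.1; F. Charles, E. Markman, Compos.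
Math. 149 (2013) Thm. 1.1; K. O'Grady, Commun. Contemp. Math. 10 (2008) §2–3; E. Cattani, P. Deligne, A. Kaplan, JAMS 8
(1995) Cor. 1.2.
-/

noncomputable section

set_option linter.dupNamespace false

open Module CategoryTheory MonoidalCategory CartesianMonoidalCategory AlgebraicGeometry Polynomial
open Literature.AlgebraicTopology.SingularHomology Literature.Geometry.Kaehler
open Literature.AlgebraicGeometry Literature.AlgebraicGeometry.Motives Literature.AlgebraicGeometry.HodgeTheory
open Literature.AlgebraicGeometry.Hyperkaehler Literature.AlgebraicGeometry.Surfaces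
open Summit.HodgeConjecture.HodgeConjecture.Theorems.NikulinTwinTransport
open Summit.HodgeConjecture.HodgeConjecture.Theorems.MarkmanPartnerTransport.BBFPositivity

namespace Summit.HodgeConjecture.HodgeConjecture.Theorems.MarkmanPartnerTransport.PartnerLattice

/-- `MarkedK3Sq[X, φ, P, z]`: VERBATIM the `let MarkedK3Sq := …` binder of the route declarations of
MarkmanPartnerTransport (clauses (m1)–(m6)). Local notation only. -/
local notation3 (prettyPrint := false) "MarkedK3Sq[" X ", " φ ", " P ", " z "]" =>
  (((IsIntegralClass P ∧ ∀ Q : complexBetti X (2 * 4), IsIntegralClass Q → ∃ n : ℤ, Q = n • P) ∧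
    (∀ c : complexBetti X 2, IsIntegralClass c ↔ ∃ v : K3HilbertIndex → ℤ, φ c = fun i => (v i : ℂ)) ∧
    (∀ a : complexBetti X 2, cupPowTwo a 4 = ((3 : ℂ) * (k3HilbertForm 2 (φ a) (φ a)) ^ 2) • P) ∧
    (IsOfHodgeType 4 X 2 2 0 (LinearEquiv.symm φ z) ∧
      ∀ τ : complexBetti X 2, IsOfHodgeType 4 X 2 2 0 τ → ∃ t : ℂ, τ = t • LinearEquiv.symm φ z) ∧
    (∀ c : complexBetti X 2, IsOfHodgeType 4 X 2 1 1 c ↔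
      (k3HilbertForm 2 (φ c) z = 0 ∧ k3HilbertForm 2 (φ c) (star z) = 0)) ∧
    (k3HilbertForm 2 z z = 0 ∧ 0 < (k3HilbertForm 2 (star z) z).re)))

/-- `SpIso[X, φ]`: VERBATIM the `let SpannedByIsometries := …` binder of the route declarations. Local notation only. -/
local notation3 (prettyPrint := false) "SpIso[" X ", " φ "]" =>
  (∀ f : complexBetti X 2 →ₗ[ℂ] complexBetti X 2, (∀ y, IsRationalClass y → IsRationalClass (f y)) →
    (∀ (i j : ℕ) y, IsOfHodgeType 4 X 2 i j y → IsOfHodgeType 4 X 2 i j (f y)) →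
    (∀ d : complexBetti X 2, d ∈ algebraicClasses X 1 → f d = 0) →
    (∀ y : complexBetti X 2, ∀ d : complexBetti X 2, d ∈ algebraicClasses X 1 →
      k3HilbertForm 2 (φ (f y)) (φ d) = 0) →
    ∃ (k : ℕ) (c : Fin k → ℚ) (g : Fin k → (complexBetti X 2 →ₗ[ℂ] complexBetti X 2)),
      (∀ i, Function.Bijective (g i) ∧ (∀ y, IsRationalClass y → IsRationalClass (g i y)) ∧
        (∀ (a b : ℕ) y, IsOfHodgeType 4 X 2 a b y → IsOfHodgeType 4 X 2 a b (g i y)) ∧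
        (∀ a b, k3HilbertForm 2 (φ (g i a)) (φ (g i b)) = k3HilbertForm 2 (φ a) (φ b))) ∧
      ∀ y : complexBetti X 2, (∀ d : complexBetti X 2, d ∈ algebraicClasses X 1 →
        k3HilbertForm 2 (φ y) (φ d) = 0) → f y = ∑ i : Fin k, ((c i : ℂ) • g i y))

/-- `RMgenWith[X, φ, z, d, θ]`: the body of `RMgen[X, φ, z, d]` of `…LowPicardRMCells` for a GIVEN `θ` (rational,
type-preserving, `q`-self-adjoint, real `σ`-eigenvalue of minimal-polynomial degree `d`, `d · n + ρ(X) = 23`, GEN). Local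
notation only. -/
local notation3 (prettyPrint := false) "RMgenWith[" X ", " φ ", " z ", " d ", " θ "]" =>
  ((∀ y, IsRationalClass y → IsRationalClass (θ y)) ∧
    (∀ (i j : ℕ) y, IsOfHodgeType 4 X 2 i j y → IsOfHodgeType 4 X 2 i j (θ y)) ∧
    (∀ y w : complexBetti X 2, k3HilbertForm 2 (φ (θ y)) (φ w) = k3HilbertForm 2 (φ y) (φ (θ w))) ∧
    ∃ ev : ℂ, θ (LinearEquiv.symm φ z) = ev • LinearEquiv.symm φ z ∧ ev.im = 0 ∧
      (minpoly ℚ ev).natDegree = d ∧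
      (∃ n : ℕ, 3 ≤ n ∧ d * n + Module.finrank ℂ ↥(algebraicClasses X 1) = 23) ∧
      ∀ f : complexBetti X 2 →ₗ[ℂ] complexBetti X 2, (∀ y, IsRationalClass y → IsRationalClass (f y)) →
        (∀ (i j : ℕ) y, IsOfHodgeType 4 X 2 i j y → IsOfHodgeType 4 X 2 i j (f y)) →
        ∃ c : Fin d → ℚ, ∀ y : complexBetti X 2,
          (∀ a : complexBetti X 2, a ∈ algebraicClasses X 1 → k3HilbertForm 2 (φ y) (φ a) = 0) →
            f y = ∑ i : Fin d, ((c i : ℂ) • (θ ^ (i : ℕ)) y))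

/-- `RMgen[X, φ, z, d]`: VERBATIM `…LowPicardRMCells` (`∃ θ, RMgenWith[X, φ, z, d, θ]`). Local notation only. -/
local notation3 (prettyPrint := false) "RMgen[" X ", " φ ", " z ", " d "]" =>
  (∃ θ : complexBetti X 2 →ₗ[ℂ] complexBetti X 2, RMgenWith[X, φ, z, d, θ])

/-- `CellHC[ρ, d]`: VERBATIM `…LowPicardRMCells` — HC⁴ on the cell `(ρ(X), [E:ℚ]) = (ρ, d)`. Local notation only. -/
local notation3 (prettyPrint := false) "CellHC[" ρ ", " d "]" =>
  (∀ (X : SchemeOver ℂ), IsSmoothProjective 4 X → IsOfK3HilbertSquareType X →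
    ∀ (φ : complexBetti X 2 ≃ₗ[ℂ] (K3HilbertIndex → ℂ)) (P : complexBetti X (2 * 4)) (z : K3HilbertIndex → ℂ),
      MarkedK3Sq[X, φ, P, z] → ¬ SpIso[X, φ] → Module.finrank ℂ ↥(algebraicClasses X 1) = ρ →
        RMgen[X, φ, z, d] → HodgeConjectureFor 4 X)

/-- `Kap[φ, g] = Σ_{ij} (G⁻¹)_{ij} · φ⁻¹eᵢ ∪ g(φ⁻¹eⱼ) ∈ H⁴(X(ℂ); ℂ)`: VERBATIM the kappa class of `…KappaClassHodge`.
Local notation only. -/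
local notation3 (prettyPrint := false) "Kap[" φ ", " g "]" =>
  (∑ i : K3HilbertIndex, ∑ j : K3HilbertIndex,
    (((k3HilbertGram 2).map (Int.cast : ℤ → ℂ))⁻¹ i j) •
      cupProduct (rfl : 2 + 2 = 2 * 2) ((LinearEquiv.symm φ) (Pi.single i 1))
        (g ((LinearEquiv.symm φ) (Pi.single j 1))))

/-- `NLDescentX[X, φ, θ]`: **the displayed Noether–Lefschetz absorption family through `X`** — an algebraic class
`w ∈ A²(X)` (the `Sym² NS` correction), a smooth projective family `g : 𝒳 → B` of relative dimension `4` (quasi-projective total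
space; smooth, irreducible, quasi-projective base), a continuous section `σ` of `FiberClass g 4`, a point `b₁` with
`X ≅ 𝒳_{b₁}` at which the value of `σ` is `κ_θ + w`, such that for a RESIDUAL set of `b ∈ B(ℂ)` the value of `σ` is a rational
class of type `(2,2)` and the fibre is isomorphic to a marked smooth projective `K3^{[2]}`-type fourfold in cell `(1,2)`
(`¬ SpannedByIsometries`, `ρ = 1`, `RMgen` of degree `2`). An `∃`-statement, not a definition; NOT constructed in the tree.
[cite: GeemenSchutt2023, §2.6, Prop. 3.2 and §3.4] [cite: VoisinHodgeII2003, §5.3.4 and §7.3.2] -/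
local notation3 (prettyPrint := false) "NLDescentX[" X ", " φ ", " θ "]" =>
  (∃ w : complexBetti X (2 * 2), w ∈ algebraicClasses X 2 ∧
    ∃ (𝒳 B : SchemeOver ℂ) (g : 𝒳 ⟶ B),
      IsSmoothProjectiveFamily g 4 ∧ IsQuasiProjectiveOver 𝒳 ∧ IsQuasiProjectiveOver B ∧
      AlgebraicGeometry.Smooth B.hom ∧ IrreducibleSpace B.left ∧
      ∃ (σ : ComplexPoints B → FiberClass g (2 * 2)) (hpt : ∀ b, (σ b).pt = b), Continuous σ ∧
      ∃ (b₁ : ComplexPoints B) (e₁ : X ≅ fiberOver g b₁),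
        complexBetti.map e₁.hom (2 * 2) ((σ b₁).clsAt (hpt b₁)) = Kap[φ, θ] + w ∧
        ∀ᶠ b in residual (ComplexPoints B),
          IsRationalClass ((σ b).clsAt (hpt b)) ∧
          IsOfHodgeType 4 (fiberOver g b) (2 * 2) 2 2 ((σ b).clsAt (hpt b)) ∧
          ∃ (X' : SchemeOver ℂ) (_ : fiberOver g b ≅ X') (_ : IsSmoothProjective 4 X') (_ : IsOfK3HilbertSquareType X')
            (φ' : complexBetti X' 2 ≃ₗ[ℂ] (K3HilbertIndex → ℂ)) (P' : complexBetti X' (2 * 4)) (z' : K3HilbertIndex → ℂ),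
            MarkedK3Sq[X', φ', P', z'] ∧ ¬ SpIso[X', φ'] ∧ Module.finrank ℂ ↥(algebraicClasses X' 1) = 1 ∧
            RMgen[X', φ', z', 2])

variable {X 𝒳 B : SchemeOver ℂ} {φ : complexBetti X 2 ≃ₗ[ℂ] (K3HilbertIndex → ℂ)} {P : complexBetti X (2 * 4)}
  {z : K3HilbertIndex → ℂ}

/-! ### HC⁴(X) from a residual family carrying the kappa class -/

/-- **HC⁴ for a marked `K3^{[2]}`-type fourfold from a family whose flat class is ALGEBRAIC ON THE VERY GENERAL FIBRE and
restricts to `κ_θ` modulo `A²(X)`.** For `X` marked smooth projective of `K3^{[2]}`-type, `θ` rational, type-preserving,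
`q`-self-adjoint with the GEN clause, `g : 𝒳 → B` a smooth projective family through `X ≅ 𝒳_{b₁}` and `σ` a continuous section
of `FiberClass g 4` with `σ(b₁)|_X = κ_θ + w` (`w ∈ A²(X)`) whose values over a residual set of `b` are rational `(2,2)`-classes on
fibres satisfying HC⁴: `HodgeConjectureFor 4 X`. Chain: residual spread (`VeryGeneralSpread…of_section`) ⟹ `σ(b₁)` algebraic
⟹ `κ_θ` algebraic ⟹ `θ` cycle-induced (`exists_corrAction_eq_of_kappaClass`) ⟹ HC⁴(X) (`X`-side F4).
[cite: VoisinHodgeII2003, Thm. 4.18 and §7.3.2] [cite: CharlesSchnell2014Notes, Prop. 11.3.11]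
[cite: CharlesMarkman2013, Thm. 1.1] [cite: OGrady2008NumericalK3Square, §2–3] -/
theorem hodgeConjectureFor_of_residualFamily_kappaClass
    (hV : VerbitskyGuan_cohomology_K3HilbertSquareType) (hO : OGrady2008_dualBBFClass_algebraic)
    (hCM : CharlesMarkman2013_lefschetzStandard_K3HilbertType)
    (hX : IsSmoothProjective 4 X) (hK : IsOfK3HilbertSquareType X) (hM : MarkedK3Sq[X, φ, P, z])
    (θ : complexBetti X 2 →ₗ[ℂ] complexBetti X 2)
    (hθ_rat : ∀ y, IsRationalClass y → IsRationalClass (θ y))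
    (hθ_typ : ∀ (a b : ℕ) y, IsOfHodgeType 4 X 2 a b y → IsOfHodgeType 4 X 2 a b (θ y))
    (hθ_sa : ∀ y w : complexBetti X 2, k3HilbertForm 2 (φ (θ y)) (φ w) = k3HilbertForm 2 (φ y) (φ (θ w)))
    (hgen : ∀ f : complexBetti X 2 →ₗ[ℂ] complexBetti X 2, (∀ y, IsRationalClass y → IsRationalClass (f y)) →
      (∀ (i j : ℕ) y, IsOfHodgeType 4 X 2 i j y → IsOfHodgeType 4 X 2 i j (f y)) →
      (∀ d : complexBetti X 2, d ∈ algebraicClasses X 1 → f d = 0) →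
      (∀ y : complexBetti X 2, ∀ d : complexBetti X 2, d ∈ algebraicClasses X 1 →
        k3HilbertForm 2 (φ (f y)) (φ d) = 0) →
      ∃ (n : ℕ) (a : Fin n → ℚ), ∀ y : complexBetti X 2,
        (∀ d : complexBetti X 2, d ∈ algebraicClasses X 1 → k3HilbertForm 2 (φ y) (φ d) = 0) →
        f y = ∑ i : Fin n, ((a i : ℂ) • (θ ^ (i : ℕ)) y))
    (g : 𝒳 ⟶ B) (hg : IsSmoothProjectiveFamily g 4) (h𝒳 : IsQuasiProjectiveOver 𝒳) (hB : IsQuasiProjectiveOver B)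
    (hBsm : AlgebraicGeometry.Smooth B.hom) [IrreducibleSpace B.left]
    (σ : ComplexPoints B → FiberClass g (2 * 2)) (hσ : Continuous σ) (hpt : ∀ b, (σ b).pt = b)
    (b₁ : ComplexPoints B) (e₁ : X ≅ fiberOver g b₁) {w : complexBetti X (2 * 2)} (hw : w ∈ algebraicClasses X 2)
    (hval : complexBetti.map e₁.hom (2 * 2) ((σ b₁).clsAt (hpt b₁)) = Kap[φ, θ] + w)
    (hHC : ∀ᶠ b in residual (ComplexPoints B), HodgeConjectureFor 4 (fiberOver g b))
    (hrat : ∀ᶠ b in residual (ComplexPoints B), IsRationalClass ((σ b).clsAt (hpt b)))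
    (htyp : ∀ᶠ b in residual (ComplexPoints B), IsOfHodgeType 4 (fiberOver g b) (2 * 2) 2 2 ((σ b).clsAt (hpt b))) :
    HodgeConjectureFor 4 X := by
  have hb₁ : (σ b₁).clsAt (hpt b₁) ∈ algebraicClasses (fiberOver g b₁) 2 :=
    VeryGeneralSpread.forall_cls_mem_algebraicClasses_of_residual_hodgeConjectureFor_of_section g hg h𝒳 hB hBsm σ hσ
      hpt hHC hrat htyp b₁
  have hX₁ : complexBetti.map e₁.hom (2 * 2) ((σ b₁).clsAt (hpt b₁)) ∈ algebraicClasses X 2 :=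
    map_mem_algebraicClasses_of_isIso e₁.hom hb₁
  have hκ : Kap[φ, θ] ∈ algebraicClasses X 2 := by
    have h := (algebraicClasses X 2).sub_mem hX₁ hw
    rwa [hval, add_sub_cancel_right] at h
  obtain ⟨Z, hZ, hcorr⟩ := exists_corrAction_eq_of_kappaClass hV hCM hX hK hM θ hθ_sa hκ
  exact hodgeConjectureFor_of_cycleInducedGenerator_of_charlesMarkman hV hO hCM hX hK hM θ hθ_rat hθ_typ ⟨Z, hZ, hcorr⟩
    hgen

/-! ### Cell `(3,2)` from cell `(1,2)` -/

/-- **«NL-DESCENT-X»: `CellHC[3, 2]` from `CellHC[1, 2]` and the displayed absorption families.** GRANTED Verbitsky–Guan,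
O'Grady, Charles–Markman, the displayed families `NLDescentX[X, φ, θ]` for every marked smooth projective `K3^{[2]}`-type `X`
in cell `(3,2)` and every `RMgen`-datum `θ` of degree `2` (moduli input (I1′-X); they exist for EVERY member by the
sign-flipped lattice lemma of memo NL-ASCENT §4 — not constructed here), and HC⁴ on the ORPHAN cell `(1,2)`: HC⁴ on the cell
`(3,2)`. The residual fibres of the family are cell-`(1,2)` fourfolds, where `CellHC[1, 2]` applies (transported along
`𝒳_b ≅ X'`), and `hodgeConjectureFor_of_residualFamily_kappaClass` concludes (the GEN clause of `RMgen` is the `X`-side F4's).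
[cite: GeemenSchutt2023, §2.6, Prop. 3.2 and §3.4] [cite: VoisinHodgeII2003, §7.3.2] [cite: CharlesMarkman2013, Thm. 1.1]
[cite: Markman2024, §1.1 Thm. 1.1] -/
theorem cellHC_three_two_of_nlDescentX
    (hV : VerbitskyGuan_cohomology_K3HilbertSquareType) (hO : OGrady2008_dualBBFClass_algebraic)
    (hCM : CharlesMarkman2013_lefschetzStandard_K3HilbertType)
    (hDesc : ∀ (X : SchemeOver ℂ), IsSmoothProjective 4 X → IsOfK3HilbertSquareType X →
      ∀ (φ : complexBetti X 2 ≃ₗ[ℂ] (K3HilbertIndex → ℂ)) (P : complexBetti X (2 * 4)) (z : K3HilbertIndex → ℂ),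
        MarkedK3Sq[X, φ, P, z] → ¬ SpIso[X, φ] → Module.finrank ℂ ↥(algebraicClasses X 1) = 3 →
        ∀ θ : complexBetti X 2 →ₗ[ℂ] complexBetti X 2, RMgenWith[X, φ, z, 2, θ] → NLDescentX[X, φ, θ])
    (h12 : CellHC[1, 2]) : CellHC[3, 2] := by
  intro X hX hK φ P z hM hnsp hρ hR
  obtain ⟨θ, hθ⟩ := hR
  obtain ⟨hθ_rat, hθ_typ, hθ_sa, ev, hev, hevim, hdeg, hn, hgenθ⟩ := id hθ
  obtain ⟨w, hw, 𝒳, B, g, hg, h𝒳, hBq, hBsm, hirr, σ, hpt, hσ, b₁, e₁, hval, hres⟩ :=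
    hDesc X hX hK φ P z hM hnsp hρ θ hθ
  haveI := hirr
  refine hodgeConjectureFor_of_residualFamily_kappaClass hV hO hCM hX hK hM θ hθ_rat hθ_typ hθ_sa ?_ g hg h𝒳 hBq hBsm
    σ hσ hpt b₁ e₁ hw hval ?_ ?_ ?_
  · intro f hf_rat hf_typ _ _
    obtain ⟨c, hc⟩ := hgenθ f hf_rat hf_typ
    exact ⟨2, c, hc⟩
  · filter_upwards [hres] with b hb
    obtain ⟨-, -, X', e', hX', hK', φ', P', z', hM', hnsp', hρ', hR'⟩ := hb
    exact (hodgeConjectureFor_iff_of_iso' e').2 (h12 X' hX' hK' φ' P' z' hM' hnsp' hρ' hR')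
  · filter_upwards [hres] with b hb
    exact hb.1
  · filter_upwards [hres] with b hb
    exact hb.2.1

end Summit.HodgeConjecture.HodgeConjecture.Theorems.MarkmanPartnerTransport.PartnerLattice

end
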